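import Literature.Analysis.UnboundedOperators.LinearizedBoltzmannFluxMoments
import Literature.Analysis.UnboundedOperators.LinearizedBoltzmannGaussWeightAction
import HarnessLib

/-!
# The hard-sphere gain operator on the quartic weight `Φ = (1 + |·|²)²` (`ℝ³`)

Sibling proof file of `LinearizedBoltzmannGaussWeightAction` (Gaussian weights). For the first gain
integral of the linearised hard-sphere operator of `ℝ³` around the normalised Maxwellian `M` we prove
(`lintegral_gain_fst_quarticWeight_le`)

`∫∫ ((v - v_*)·ω)₊ M(v_*) (1 + |v'|²)² dω dv_* ≤ π (1 + |v|²)³/(3|v|) + K_Φ (1 + |v|²)²`,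
`K_Φ = 3 σ(S²) ∫ (1 + |w|)⁵ dM`   (`v ≠ 0`),

with SHARP leading term: since `ν(v) ≥ π|v|` (`pi_mul_norm_le_collisionFrequency`), the two gain pieces
give `ν⁻¹ K₂ Φ ≤ (2/3)(1 + |v|⁻²) Φ + O(Φ/|v|)`, the eigenvalue `λ = 4/(α + 2) = 2/3` at `α = 4` of the
energy-sphere averaging operator to which `ν⁻¹ K₂` reduces at large speed (Archimedes: `|v'|²/|v|²` is
asymptotically uniform on `[0, 1]` under the collision law). Ingredients: the exact energy bookkeeping
`1 + |v'|² = (1 + |v|² - ⟪v,ω⟫²) + ⟪v_*,ω⟫²` (`norm_sq_collide_fst_eq`), the elementary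
`hardSphereKernel_mul_quartic_collide_le`, the flux moment `lintegral_toSphere_posPart_mul_quartic_le`,
and Gaussian moments. Weights `(1 + |v|²)^k` are supersolutions exactly for `k > 1` (`λ < 1` iff `α > 2`);
`k = 2` is chosen for its polynomial algebra. No new definitions are introduced.
-/

open MeasureTheory Metric Real Set Filter Topology ProbabilityTheory Module
open scoped InnerProductSpace ENNReal

namespace Literature.Analysis.UnboundedOperators

noncomputable section

open Literature.MathematicalPhysics.KineticTheory (collide sphereMeasure hardSphereKernel)
open Literature.Analysis.FluidPDE

/-! ### The gain operator on the quartic weight `Φ = (1 + |·|²)²` -/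

/-- Algebra of the quartic weight after a collision: with `X = 1 + |v|² - ⟪v, ω⟫²`,
`((v - v_*)·ω)₊ (1 + |v'|²)² ≤ (v·ω)₊ X² + 3 (1 + |v|²)² (1 + |v_*|)⁵`. [folklore] -/
theorem hardSphereKernel_mul_quartic_collide_le (ω : sphere (0 : EuclideanSpace ℝ (Fin 3)) 1)
    (v w : EuclideanSpace ℝ (Fin 3)) :
    hardSphereKernel (v, w) ω * (1 + ‖(collide ω (v, w)).1‖ ^ 2) ^ 2 ≤
      hardSphereKernel (v, 0) ω * (1 + ‖v‖ ^ 2 - ⟪v, (ω : EuclideanSpace ℝ (Fin 3))⟫_ℝ ^ 2) ^ 2 +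
        3 * (1 + ‖v‖ ^ 2) ^ 2 * (1 + ‖w‖) ^ 5 := by
  set a : ℝ := ⟪v, (ω : EuclideanSpace ℝ (Fin 3))⟫_ℝ with ha
  set c : ℝ := ⟪w, (ω : EuclideanSpace ℝ (Fin 3))⟫_ℝ with hc
  set P : ℝ := 1 + ‖v‖ ^ 2 with hP
  set t : ℝ := ‖w‖ with ht
  set X : ℝ := 1 + ‖v‖ ^ 2 - a ^ 2 with hX
  set B : ℝ := hardSphereKernel (v, w) ω with hB
  set B₀ : ℝ := hardSphereKernel (v, 0) ω with hB₀
  have ht0 : 0 ≤ t := norm_nonneg _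
  have hP1 : 1 ≤ P := by rw [hP]; nlinarith [norm_nonneg v]
  have ha2 : a ^ 2 ≤ ‖v‖ ^ 2 := by
    rw [← sq_abs]; exact pow_le_pow_left₀ (abs_nonneg _) (abs_inner_sphere_le v ω) 2
  have hc2 : c ^ 2 ≤ t ^ 2 := by
    rw [← sq_abs, ht]; exact pow_le_pow_left₀ (abs_nonneg _) (abs_inner_sphere_le w ω) 2
  have hX1 : 1 ≤ X := by rw [hX]; linarith
  have hXP : X ≤ P := by rw [hX, hP]; nlinarith
  have hB0 : 0 ≤ B := le_max_right _ _
  have hB₀0 : 0 ≤ B₀ := le_max_right _ _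
  have hBle : B ≤ B₀ + t := hardSphereKernel_le_posPart_add_norm v w ω
  have hB₀le : B₀ ≤ P := by
    have h1 : B₀ ≤ ‖v‖ := by
      rw [hB₀]; simp only [hardSphereKernel, sub_zero]
      exact max_le ((le_abs_self _).trans (abs_inner_sphere_le v ω)) (norm_nonneg _)
    rw [hP]; nlinarith [norm_nonneg v]
  have hcol : 1 + ‖(collide ω (v, w)).1‖ ^ 2 = X + c ^ 2 := by
    rw [norm_sq_collide_fst_eq, hX, ha, hc]; ring
  rw [hcol]
  -- `(X + c²)² ≤ X² + t² (2P + t²)`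
  have hsq : (X + c ^ 2) ^ 2 ≤ X ^ 2 + t ^ 2 * (2 * P + t ^ 2) := by
    nlinarith [sq_nonneg c, mul_le_mul hc2 hc2 (sq_nonneg c) (sq_nonneg t), mul_le_mul hc2 hXP (by linarith) (sq_nonneg t)]
  -- the remainder `t X² + (B₀ + t) t² (2P + t²) ≤ 3 P² (1 + t)⁵`
  have hrem : t * X ^ 2 + (B₀ + t) * (t ^ 2 * (2 * P + t ^ 2)) ≤ 3 * P ^ 2 * (1 + t) ^ 5 := by
    have h1 : t * X ^ 2 ≤ P ^ 2 * (1 + t) ^ 5 := by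
      have : X ^ 2 ≤ P ^ 2 := pow_le_pow_left₀ (by linarith) hXP 2
      have h15 : t ≤ (1 + t) ^ 5 := by nlinarith [pow_le_pow_left₀ (by linarith : (0 : ℝ) ≤ 1) (by linarith : (1 : ℝ) ≤ 1 + t) 4]
      calc t * X ^ 2 ≤ t * P ^ 2 := mul_le_mul_of_nonneg_left this ht0
        _ = P ^ 2 * t := by ring
        _ ≤ P ^ 2 * (1 + t) ^ 5 := mul_le_mul_of_nonneg_left h15 (sq_nonneg _)
    have h2 : (B₀ + t) * (t ^ 2 * (2 * P + t ^ 2)) ≤ 2 * P ^ 2 * (1 + t) ^ 5 := by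
      have i1 : B₀ + t ≤ P * (1 + t) := by nlinarith
      have i2 : 2 * P + t ^ 2 ≤ 2 * P * (1 + t) ^ 2 := by nlinarith [sq_nonneg t]
      have i3 : t ^ 2 ≤ (1 + t) ^ 2 := by nlinarith
      calc (B₀ + t) * (t ^ 2 * (2 * P + t ^ 2)) ≤ (P * (1 + t)) * ((1 + t) ^ 2 * (2 * P * (1 + t) ^ 2)) := by
            refine mul_le_mul i1 (mul_le_mul i3 i2 (by positivity) (by positivity)) (by positivity) (by positivity)
        _ = 2 * P ^ 2 * (1 + t) ^ 5 := by ring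
    linarith
  calc B * (X + c ^ 2) ^ 2 ≤ (B₀ + t) * (X ^ 2 + t ^ 2 * (2 * P + t ^ 2)) :=
        mul_le_mul hBle hsq (sq_nonneg _) (add_nonneg hB₀0 ht0)
    _ = B₀ * X ^ 2 + (t * X ^ 2 + (B₀ + t) * (t ^ 2 * (2 * P + t ^ 2))) := by ring
    _ ≤ B₀ * X ^ 2 + 3 * P ^ 2 * (1 + t) ^ 5 := add_le_add le_rfl hrem

/-- `∫ M(w) dw = 1` as a lower integral (`M dv` is a probability measure). [folklore] -/
theorem lintegral_ofReal_globalMaxwellian_eq_one :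
    ∫⁻ w : EuclideanSpace ℝ (Fin 3), ENNReal.ofReal (globalMaxwellian w) = 1 := by
  have h := stdGaussian_eq_withDensity_globalMaxwellian_holds (E := EuclideanSpace ℝ (Fin 3))
  have : (stdGaussian (EuclideanSpace ℝ (Fin 3))) Set.univ = 1 := measure_univ
  rw [h, withDensity_apply _ MeasurableSet.univ, Measure.restrict_univ] at this
  exact this

/-- `∫ M(w) (1 + |w|)⁵ dw = ∫ (1 + |w|)⁵ dM(w)` as a lower integral, finite. [folklore] -/
theorem lintegral_ofReal_globalMaxwellian_mul_pow_five :
    ∫⁻ w : EuclideanSpace ℝ (Fin 3), ENNReal.ofReal (globalMaxwellian w * (1 + ‖w‖) ^ 5) =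
      ENNReal.ofReal (∫ w, (1 + ‖w‖) ^ 5 ∂stdGaussian (EuclideanSpace ℝ (Fin 3))) := by
  have hM : Measurable fun v : EuclideanSpace ℝ (Fin 3) => ENNReal.ofReal (globalMaxwellian v) :=
    continuous_globalMaxwellian.measurable.ennreal_ofReal
  have hi := integrable_one_add_norm_pow_stdGaussian (E := EuclideanSpace ℝ (Fin 3)) 5
  rw [ofReal_integral_eq_lintegral_ofReal hi (Eventually.of_forall fun w => by positivity),
    stdGaussian_eq_withDensity_globalMaxwellian_holds,
    lintegral_withDensity_eq_lintegral_mul _ hM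
      ((by fun_prop : Continuous fun w : EuclideanSpace ℝ (Fin 3) => (1 + ‖w‖) ^ 5).measurable.ennreal_ofReal)]
  refine lintegral_congr fun w => ?_
  simp only [Pi.mul_apply]
  rw [← ENNReal.ofReal_mul (globalMaxwellian_pos w).le]

/-- **The first gain integral of the quartic weight `Φ = (1 + |·|²)²` (`ℝ³`)**: for `v ≠ 0`,
`∫∫ ((v - v_*)·ω)₊ M(v_*) (1 + |v'|²)² dω dv_* ≤ π (1 + |v|²)³/(3|v|) + K_Φ (1 + |v|²)²` with
`K_Φ = 3 σ(S²) ∫ (1 + |w|)⁵ dM`. The leading term is sharp: `(π|v|/3)|v|⁴ = (2/3)·(ν(v)/2)·Φ(v)` to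
leading order, i.e. `ν⁻¹ K₂ Φ → (2/3) Φ` — the eigenvalue `4/(α + 2)` of the energy-sphere average at
`α = 4`, strictly below `1`, which is what makes `Φ` a supersolution (unlike `α ≤ 2`). [folklore] -/
theorem lintegral_gain_fst_quarticWeight_le {v : EuclideanSpace ℝ (Fin 3)} (hv : v ≠ 0) :
    ∫⁻ w, ∫⁻ ω, ENNReal.ofReal (hardSphereKernel (v, w) ω * globalMaxwellian w) *
        ENNReal.ofReal ((1 + ‖(collide ω (v, w)).1‖ ^ 2) ^ 2) ∂sphereMeasure ≤
      ENNReal.ofReal (Real.pi * (1 + ‖v‖ ^ 2) ^ 3 / (3 * ‖v‖) +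
        3 * (sphereMeasure : Measure (sphere (0 : EuclideanSpace ℝ (Fin 3)) 1)).real univ *
          (∫ w, (1 + ‖w‖) ^ 5 ∂stdGaussian (EuclideanSpace ℝ (Fin 3))) * (1 + ‖v‖ ^ 2) ^ 2) := by
  haveI := isFiniteMeasure_sphereMeasure (E := EuclideanSpace ℝ (Fin 3))
  have hvn : 0 < ‖v‖ := norm_pos_iff.2 hv
  set P : ℝ := 1 + ‖v‖ ^ 2 with hP
  have hP0 : 0 ≤ P := by rw [hP]; positivity
  set S : ℝ := (sphereMeasure : Measure (sphere (0 : EuclideanSpace ℝ (Fin 3)) 1)).real univ with hS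
  have hS0 : 0 ≤ S := measureReal_nonneg
  have hSuniv : (sphereMeasure : Measure (sphere (0 : EuclideanSpace ℝ (Fin 3)) 1)) univ = ENNReal.ofReal S := by
    rw [hS, measureReal_def, ENNReal.ofReal_toReal (measure_ne_top _ _)]
  set m₅ : ℝ := ∫ w, (1 + ‖w‖) ^ 5 ∂stdGaussian (EuclideanSpace ℝ (Fin 3)) with hm₅
  have hm₅0 : 0 ≤ m₅ := integral_nonneg fun w => by positivity
  -- the two pieces of the pointwise bound
  set F₀ : sphere (0 : EuclideanSpace ℝ (Fin 3)) 1 → ℝ≥0∞ := fun ω =>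
    ENNReal.ofReal (hardSphereKernel (v, 0) ω * (P - ⟪v, (ω : EuclideanSpace ℝ (Fin 3))⟫_ℝ ^ 2) ^ 2)
    with hF₀
  have hF₀m : Measurable F₀ := by
    have : Continuous fun ω : sphere (0 : EuclideanSpace ℝ (Fin 3)) 1 =>
        hardSphereKernel (v, 0) ω * (P - ⟪v, (ω : EuclideanSpace ℝ (Fin 3))⟫_ℝ ^ 2) ^ 2 := by
      unfold hardSphereKernel; fun_prop
    exact this.measurable.ennreal_ofReal
  have hpt : ∀ w ω, ENNReal.ofReal (hardSphereKernel (v, w) ω * globalMaxwellian w) *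
      ENNReal.ofReal ((1 + ‖(collide ω (v, w)).1‖ ^ 2) ^ 2) ≤
      ENNReal.ofReal (globalMaxwellian w) * F₀ ω + ENNReal.ofReal (globalMaxwellian w * (1 + ‖w‖) ^ 5) *
        ENNReal.ofReal (3 * P ^ 2) := by
    intro w ω
    have hM := (globalMaxwellian_pos w).le
    have hB0 : 0 ≤ hardSphereKernel (v, w) ω := le_max_right _ _
    have hB₀0 : 0 ≤ hardSphereKernel (v, 0) ω := le_max_right _ _
    have h := hardSphereKernel_mul_quartic_collide_le ω v w
    rw [← hP] at h
    have key : hardSphereKernel (v, w) ω * globalMaxwellian w * (1 + ‖(collide ω (v, w)).1‖ ^ 2) ^ 2 ≤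
        globalMaxwellian w * (hardSphereKernel (v, 0) ω * (P - ⟪v, (ω : EuclideanSpace ℝ (Fin 3))⟫_ℝ ^ 2) ^ 2) +
          globalMaxwellian w * (1 + ‖w‖) ^ 5 * (3 * P ^ 2) := by
      have := mul_le_mul_of_nonneg_left h hM
      nlinarith [this]
    calc ENNReal.ofReal (hardSphereKernel (v, w) ω * globalMaxwellian w) *
          ENNReal.ofReal ((1 + ‖(collide ω (v, w)).1‖ ^ 2) ^ 2)
        = ENNReal.ofReal (hardSphereKernel (v, w) ω * globalMaxwellian w * (1 + ‖(collide ω (v, w)).1‖ ^ 2) ^ 2) :=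
          (ENNReal.ofReal_mul (mul_nonneg hB0 hM)).symm
      _ ≤ ENNReal.ofReal (globalMaxwellian w * (hardSphereKernel (v, 0) ω * (P - ⟪v, (ω : EuclideanSpace ℝ (Fin 3))⟫_ℝ ^ 2) ^ 2) +
          globalMaxwellian w * (1 + ‖w‖) ^ 5 * (3 * P ^ 2)) := ENNReal.ofReal_le_ofReal key
      _ = ENNReal.ofReal (globalMaxwellian w) * F₀ ω +
          ENNReal.ofReal (globalMaxwellian w * (1 + ‖w‖) ^ 5) * ENNReal.ofReal (3 * P ^ 2) := by
          have hM5 : 0 ≤ globalMaxwellian w * (1 + ‖w‖) ^ 5 := mul_nonneg hM (pow_nonneg (by positivity) 5)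
          have h3P : 0 ≤ 3 * P ^ 2 := mul_nonneg (by norm_num) (sq_nonneg _)
          rw [ENNReal.ofReal_add (mul_nonneg hM (mul_nonneg hB₀0 (sq_nonneg _))) (mul_nonneg hM5 h3P),
            @ENNReal.ofReal_mul (globalMaxwellian w)
              (hardSphereKernel (v, 0) ω * (P - ⟪v, (ω : EuclideanSpace ℝ (Fin 3))⟫_ℝ ^ 2) ^ 2) hM,
            @ENNReal.ofReal_mul (globalMaxwellian w * (1 + ‖w‖) ^ 5) (3 * P ^ 2) hM5]
  -- integrate in `ω`
  have hω : ∀ w : EuclideanSpace ℝ (Fin 3), ∫⁻ ω, (ENNReal.ofReal (globalMaxwellian w) * F₀ ω + ENNReal.ofReal (globalMaxwellian w * (1 + ‖w‖) ^ 5) *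
        ENNReal.ofReal (3 * P ^ 2)) ∂sphereMeasure ≤
      ENNReal.ofReal (globalMaxwellian w) * ENNReal.ofReal (Real.pi * P ^ 3 / (3 * ‖v‖)) +
        ENNReal.ofReal (globalMaxwellian w * (1 + ‖w‖) ^ 5) * ENNReal.ofReal (3 * P ^ 2 * S) := by
    intro w
    rw [lintegral_add_left (hF₀m.const_mul _), lintegral_const_mul _ hF₀m, lintegral_const, hSuniv,
      mul_assoc, ← ENNReal.ofReal_mul (mul_nonneg (by norm_num) (sq_nonneg P))]
    refine add_le_add (mul_le_mul' le_rfl ?_) le_rfl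
    have h := lintegral_toSphere_posPart_mul_quartic_le hv
    rw [← hP] at h
    exact h
  -- integrate in `w`
  have hM1 := lintegral_ofReal_globalMaxwellian_eq_one
  have hM5 := lintegral_ofReal_globalMaxwellian_mul_pow_five
  rw [← hm₅] at hM5
  have hMm : Measurable fun w : EuclideanSpace ℝ (Fin 3) => ENNReal.ofReal (globalMaxwellian w) :=
    continuous_globalMaxwellian.measurable.ennreal_ofReal
  calc ∫⁻ w, ∫⁻ ω, ENNReal.ofReal (hardSphereKernel (v, w) ω * globalMaxwellian w) *
          ENNReal.ofReal ((1 + ‖(collide ω (v, w)).1‖ ^ 2) ^ 2) ∂sphereMeasure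
      ≤ ∫⁻ w, ∫⁻ ω, (ENNReal.ofReal (globalMaxwellian w) * F₀ ω +
          ENNReal.ofReal (globalMaxwellian w * (1 + ‖w‖) ^ 5) * ENNReal.ofReal (3 * P ^ 2)) ∂sphereMeasure :=
        lintegral_mono fun w => lintegral_mono fun ω => hpt w ω
    _ ≤ ∫⁻ w, (ENNReal.ofReal (globalMaxwellian w) * ENNReal.ofReal (Real.pi * P ^ 3 / (3 * ‖v‖)) +
          ENNReal.ofReal (globalMaxwellian w * (1 + ‖w‖) ^ 5) * ENNReal.ofReal (3 * P ^ 2 * S)) :=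
        lintegral_mono hω
    _ = ENNReal.ofReal (Real.pi * P ^ 3 / (3 * ‖v‖)) + ENNReal.ofReal m₅ * ENNReal.ofReal (3 * P ^ 2 * S) := by
        have e1 : ∫⁻ w : EuclideanSpace ℝ (Fin 3), ENNReal.ofReal (globalMaxwellian w) *
            ENNReal.ofReal (Real.pi * P ^ 3 / (3 * ‖v‖)) = ENNReal.ofReal (Real.pi * P ^ 3 / (3 * ‖v‖)) := by
          rw [lintegral_mul_const _ hMm, hM1, one_mul]
        have e2 : ∫⁻ w : EuclideanSpace ℝ (Fin 3), ENNReal.ofReal (globalMaxwellian w * (1 + ‖w‖) ^ 5) *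
            ENNReal.ofReal (3 * P ^ 2 * S) = ENNReal.ofReal m₅ * ENNReal.ofReal (3 * P ^ 2 * S) := by
          rw [lintegral_mul_const' _ _ ENNReal.ofReal_ne_top, hM5]
        have hm1 : Measurable fun w : EuclideanSpace ℝ (Fin 3) => ENNReal.ofReal (globalMaxwellian w) *
            ENNReal.ofReal (Real.pi * P ^ 3 / (3 * ‖v‖)) := hMm.mul_const _
        rw [lintegral_add_left hm1, e1, e2]
    _ = ENNReal.ofReal (Real.pi * P ^ 3 / (3 * ‖v‖) + 3 * S * m₅ * P ^ 2) := by
        have h1 : 0 ≤ Real.pi * P ^ 3 / (3 * ‖v‖) :=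
          div_nonneg (mul_nonneg Real.pi_pos.le (pow_nonneg hP0 3)) (mul_nonneg (by norm_num) (norm_nonneg _))
        have h2 : 0 ≤ m₅ * (3 * P ^ 2 * S) := mul_nonneg hm₅0 (mul_nonneg (mul_nonneg (by norm_num) (sq_nonneg _)) hS0)
        rw [← ENNReal.ofReal_mul hm₅0, ← ENNReal.ofReal_add h1 h2]
        congr 1
        ring

end

end Literature.Analysis.UnboundedOperators
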